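import Literature.AlgebraicGeometry.PlaneCurves.PlaneCubicWeberNormalForm
import Literature.AlgebraicGeometry.PlaneCurves.HessePencilCharacteristicThreePerfectField
import HarnessLib

/-!
# Remark 2.1 over perfect fields: a smooth cubic with two rational flexes has a Hesse form over `K` (Artebani–Dolgachev)

Topic `Literature/AlgebraicGeometry/PlaneCurves`, namespace `Literature.AlgebraicGeometry.PlaneCurves`.
Lane `lit-hodgefound`, seat `lit-hodgefound-p37`, row g21-#17; the rational version of
`HessePencilCharacteristicThreeTwoFlexes` (g21-#14, `K = K̄`): `PlaneCubicWeberNormalForm` (g21-#13,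
any field) + `HessePencilCharacteristicThreePerfectField` (g21-#16: "every element is a cube" replaces
algebraic closure; automatic for finite fields).  Everything here is PROVED; no definition, no named
fact.

Source — M. Artebani, I. Dolgachev, *The Hesse pencil of plane cubic curves*, Enseign. Math. (2) 55
(2009), §2, Remark 2.1 [`paper:arxiv-math_0611590` p0005 L58–61], VERBATIM: "… popular in
number-theory and cryptography for finding explicit algorithms for computing the number of points of an
elliptic curve over a finite field of characteristic 3 (see [Ran], [Smart]). […] The proof of the
existence of a Hesse equation for an elliptic curve `E` over a field of characteristic 3 goes through
if we assume that `E` is an ordinary elliptic curve with rational 3-torsion points."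

## Statement proved

**`exists_bind₁_eq_smul_hesseE_of_two_flexes_of_cube`**: `K` a field with `3 = 0` in which every
element is a cube; `F` a ternary cubic form with no singular `K`-point, two `K`-rational flexes
`A ≠ B` whose inflection tangents are not components ("rational 3-torsion points": with a flex as zero
the flexes are the `3`-torsion).  Then `F ∘ M = κ·E_t` for an invertible `M` OVER `K`, `κ ≠ 0`,
`t ≠ 0`.  **`…_of_finite`**: the same over every finite field of characteristic `3`.  (Over a
non-perfect `K` the conclusion can fail: the web cubic with `c = 0` is `K`-smooth when `a²b²/d` is not
a cube.)

## References
* [ArtebaniDolgachev2009] M. Artebani, I. Dolgachev, *The Hesse pencil of plane cubic curves*,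
  Enseign. Math. (2) 55 (2009) 235–273, §2, Remark 2.1; Lemma 1 (proof, eq. (4)).
* [Gibson1998] C. G. Gibson, *Elementary Geometry of Algebraic Curves*, CUP 1998, Lemma 13.2.
-/

set_option autoImplicit false

open MvPolynomial Matrix
open Literature.AlgebraicGeometry.HyperbolicPolynomials

namespace Literature.AlgebraicGeometry.PlaneCurves

universe u

/-- The member `E_t = X³ + Y³ + Z³ + t·XYZ` (local notation, no definition). -/
local notation3 "𝐄[" t "]" =>
  (X 0 ^ 3 + X 1 ^ 3 + X 2 ^ 3 + C t * (X 0 * X 1 * X 2) : MvPolynomial (Fin 3) _)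

/-- The web cubic `F = xy(ax + by + cz) + dz³` (local notation, no definition). -/
local notation3 "𝐅[" a ", " b ", " c ", " d "]" =>
  (X 0 * X 1 * (C a * X 0 + C b * X 1 + C c * X 2) + C d * X 2 ^ 3 : MvPolynomial (Fin 3) _)

section CharThreeTwoFlexesPerfect

variable {K : Type u} [Field K] {F : MvPolynomial (Fin 3) K}

/-- Singular points correspond under `F ∘ M`: if `F ∘ M` has a singular `K`-point then so does `F`
(`det M ≠ 0`). [cite: Gibson1998, Lemma 13.2] -/
theorem exists_singular_of_bind₁ {M : Matrix (Fin 3) (Fin 3) K} (hM : M.det ≠ 0)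
    {G : MvPolynomial (Fin 3) K} (hFM : bind₁ M.toMvPolynomial F = G)
    (h : ∃ q : Fin 3 → K, q ≠ 0 ∧ eval q G = 0 ∧ (fun i => eval q (pderiv i G)) = 0) :
    ∃ p : Fin 3 → K, p ≠ 0 ∧ eval p F = 0 ∧ (fun i => eval p (pderiv i F)) = 0 := by
  obtain ⟨q, hq0, hq, hgq⟩ := h
  rw [← hFM, eval_bind₁_toMvPolynomial] at hq
  rw [← hFM, grad_bind₁_toMvPolynomial_eq_zero_iff hM] at hgq
  refine ⟨M *ᵥ q, fun h0 => hq0 ?_, hq, hgq⟩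
  have := congrArg (fun w => M⁻¹ *ᵥ w) h0
  rwa [Matrix.mulVec_mulVec, Matrix.nonsing_inv_mul _ (isUnit_iff_ne_zero.2 hM), Matrix.one_mulVec,
    Matrix.mulVec_zero] at this

/-- **Artebani–Dolgachev, Remark 2.1, rationally: "the existence of a Hesse equation … goes through if
we assume that `E` is an ordinary elliptic curve with rational 3-torsion points".**  `3 = 0`, every
element of `K` a cube (perfect `K`), `F` a ternary cubic form without singular `K`-points, `A ≠ B` two
`K`-flexes whose tangents are not components: `F ∘ M = κ·E_t` over `K` with `det M ≠ 0`, `κ ≠ 0`,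
`t ≠ 0` (Weber's frame g21-#13, then g21-#16). [cite: ArtebaniDolgachev2009, §2, Remark 2.1] -/
theorem exists_bind₁_eq_smul_hesseE_of_two_flexes_of_cube (h3 : (3 : K) = 0)
    (hcube : ∀ w : K, ∃ z : K, z ^ 3 = w) (hF : F.IsHomogeneous 3)
    (hreg : ¬ ∃ p : Fin 3 → K, p ≠ 0 ∧ eval p F = 0 ∧ (fun i => eval p (pderiv i F)) = 0)
    {A B : Fin 3 → K} (hA : eval A F = 0)
    (hfA : ∀ v, (fun j => eval A (pderiv j F)) ⬝ᵥ v = 0 → LinearIndependent K ![A, v] →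
      Polynomial.X ^ 3 ∣ linePoly F A v)
    (hcompA : ∀ v, (fun j => eval A (pderiv j F)) ⬝ᵥ v = 0 → LinearIndependent K ![A, v] →
      linePoly F A v ≠ 0)
    (hB : eval B F = 0)
    (hfB : ∀ v, (fun j => eval B (pderiv j F)) ⬝ᵥ v = 0 → LinearIndependent K ![B, v] →
      Polynomial.X ^ 3 ∣ linePoly F B v)
    (hcompB : ∀ v, (fun j => eval B (pderiv j F)) ⬝ᵥ v = 0 → LinearIndependent K ![B, v] →
      linePoly F B v ≠ 0)
    (hAB : LinearIndependent K ![A, B]) :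
    ∃ (M : Matrix (Fin 3) (Fin 3) K) (κ t : K), M.det ≠ 0 ∧ κ ≠ 0 ∧ t ≠ 0 ∧
      bind₁ M.toMvPolynomial F = κ • (𝐄[t] : MvPolynomial (Fin 3) K) := by
  obtain ⟨M₁, a, b, c, d, hM₁, -, -, hweb⟩ :=
    exists_bind₁_eq_web_of_two_flexes hF hA hfA hcompA hB hfB hcompB hAB
  have hns : ¬ ∃ q : Fin 3 → K, q ≠ 0 ∧ eval q 𝐅[a, b, c, d] = 0 ∧
      (fun i => eval q (pderiv i 𝐅[a, b, c, d])) = 0 :=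
    fun h => hreg (exists_singular_of_bind₁ hM₁ hweb h)
  obtain ⟨M₂, κ, t, hM₂, hκ, ht, h₂⟩ := web_exists_bind₁_eq_smul_hesseE_of_cube h3 hcube hns
  refine ⟨M₁ * M₂, κ, t, ?_, hκ, ht, ?_⟩
  · rw [Matrix.det_mul]; exact mul_ne_zero hM₁ hM₂
  · rw [bind₁_toMvPolynomial_mul, hweb, h₂]

/-- **… over every finite field of characteristic `3`** ("an elliptic curve over a finite field of
characteristic 3"). [cite: ArtebaniDolgachev2009, §2, Remark 2.1] -/
theorem exists_bind₁_eq_smul_hesseE_of_two_flexes_of_finite [Finite K] (h3 : (3 : K) = 0)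
    (hF : F.IsHomogeneous 3)
    (hreg : ¬ ∃ p : Fin 3 → K, p ≠ 0 ∧ eval p F = 0 ∧ (fun i => eval p (pderiv i F)) = 0)
    {A B : Fin 3 → K} (hA : eval A F = 0)
    (hfA : ∀ v, (fun j => eval A (pderiv j F)) ⬝ᵥ v = 0 → LinearIndependent K ![A, v] →
      Polynomial.X ^ 3 ∣ linePoly F A v)
    (hcompA : ∀ v, (fun j => eval A (pderiv j F)) ⬝ᵥ v = 0 → LinearIndependent K ![A, v] →
      linePoly F A v ≠ 0)
    (hB : eval B F = 0)
    (hfB : ∀ v, (fun j => eval B (pderiv j F)) ⬝ᵥ v = 0 → LinearIndependent K ![B, v] →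
      Polynomial.X ^ 3 ∣ linePoly F B v)
    (hcompB : ∀ v, (fun j => eval B (pderiv j F)) ⬝ᵥ v = 0 → LinearIndependent K ![B, v] →
      linePoly F B v ≠ 0)
    (hAB : LinearIndependent K ![A, B]) :
    ∃ (M : Matrix (Fin 3) (Fin 3) K) (κ t : K), M.det ≠ 0 ∧ κ ≠ 0 ∧ t ≠ 0 ∧
      bind₁ M.toMvPolynomial F = κ • (𝐄[t] : MvPolynomial (Fin 3) K) :=
  exists_bind₁_eq_smul_hesseE_of_two_flexes_of_cube h3 (exists_cube_root_of_finite h3) hF hreg hA hfA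
    hcompA hB hfB hcompB hAB

end CharThreeTwoFlexesPerfect

end Literature.AlgebraicGeometry.PlaneCurves
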